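import Literature.Analysis.Complex.FourierPolyaKiKimTransfer
import HarnessLib

/-!
# Persistence of Fourier critical points and the level-`0` mechanism (Ki–Kim 2000, Thm 3.1, L. 4.3)

Support file (real-variable part, 3/·) for the discharge of
`Literature.Analysis.Complex.KiKim2000_thm_4_3_noCriticalPoints`
(`Literature/Analysis/Complex/FourierPolyaKiKim.lean`), continuing
`FourierPolyaKiKimCounting.lean` and `FourierPolyaKiKimTransfer.lean`.

## Main results (all proved)

* `eventually_not_noCrit_of_tendstoUniformlyOn` — **Ki–Kim 2000, Theorem 3.1 and its Corollary,
  in the form "a critical point of the limit persists in the approximants"**: if `h` has a genuine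
  Fourier critical point (a zero `c` of `h^{(l+1)}` of finite order with `h^{(l)}(c) ≠ 0` where
  `h^{(l)}(c) h^{(l+2)}(c) < 0` fails) and the derivatives of `F_k` converge to those of `h`
  uniformly near `c`, then eventually `¬ H(F_k)`. As in the printed proof, the level sums of the
  critical-zero count over the levels `l, …, l+m` on a small window reduce to endpoint signs
  ((3.1)); Hurwitz's theorem is not needed for this direction.
* `tendsto_atTop_of_iteratedDeriv_eq_const`, `not_bounded_of_iteratedDeriv_eq_const`,
  `exists_zero_of_iteratedDeriv_eq_const_of_even` — elementary asymptotics of functions with a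
  constant non-zero derivative of some order (real polynomials).
* `bounded_of_forall_deriv_zero_lt`, `bounded_of_forall_deriv_zero_mul_lt` — the mechanism of the
  proof of Ki–Kim's Lemma 4.3 at level `0`: if `F` is zero-free and every zero `a` of `F'` is
  "good" (`F(a) F''(a) < 0`, i.e. not critical), then `F'` has at most one zero and `F` is bounded.
* `exists_genuine_crit_of_iteratedDeriv_eq_const` — de Gua's rule in its weakest form: a zero-free
  real polynomial of positive degree has a genuine Fourier critical point.

## References

* H. Ki, Y.-O. Kim, Duke Math. J. 104 (2000) 45–73: §1 (de Gua's rule), Theorem 3.1 and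
  Corollary p. 54–55, Lemma 4.3 p. 59 [KiKim2000].
-/

noncomputable section

open Filter Set Topology
open scoped Topology

namespace Literature.Analysis.Complex
namespace KiKim


section semicontinuity

/-- If `u` is closer to `w` than `|w|`, then `u` and `w` have the same sign. [folklore] -/
theorem sign_eq_of_abs_sub_lt {u w : ℝ} (h : |u - w| < |w|) : SignType.sign u = SignType.sign w := by
  rcases lt_trichotomy w 0 with hw | hw | hw
  · rw [sign_neg hw, sign_neg]
    rw [abs_of_neg hw] at h
    linarith [le_abs_self (u - w)]
  · subst hw; exact absurd h (by simp)
  · rw [sign_pos hw, sign_pos]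
    rw [abs_of_pos hw] at h
    linarith [neg_abs_le (u - w)]

/-- A continuous function that does not vanish on a compact interval stays away from `0` there,
and so does every uniformly close function; quantitative form. [folklore] -/
theorem exists_pos_forall_le_abs {G : ℝ → ℝ} {a b : ℝ} (hab : a ≤ b) (hG : ContinuousOn G (Icc a b))
    (h0 : ∀ x ∈ Icc a b, G x ≠ 0) : ∃ δ > 0, ∀ x ∈ Icc a b, δ ≤ |G x| := by
  obtain ⟨x₀, hx₀, hmin⟩ := isCompact_Icc.exists_isMinOn (nonempty_Icc.mpr hab)
    (continuous_abs.comp_continuousOn hG)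
  exact ⟨|G x₀|, abs_pos.mpr (h0 x₀ hx₀), fun x hx => hmin hx⟩

variable {h : ℝ → ℝ}

/-- **Semicontinuity of critical points (Ki–Kim 2000, Theorem 3.1 and its Corollary, in the form
"`≥ 1` critical point persists", without Hurwitz's theorem).** Let `h` be real-analytic with a
genuine Fourier critical point: a zero `c` of `h^{(l+1)}` of finite order with `h^{(l)}(c) ≠ 0` at
which the condition `h^{(l)}(c) h^{(l+2)}(c) < 0` fails. If the derivatives of real-analytic
functions `F_k` converge to those of `h` uniformly on `[c-1, c+1]`, then eventually `F_k` has a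
Fourier critical point (`¬ H(F_k)`). Proof: the level sums of `fourK` over the levels `l, …, l+m`
on a small `[c-ε, c+ε]` reduce to endpoint signs ((3.1)/(3.3)), which converge.
[cite: KiKim2000, Theorem 3.1 and Corollary] -/
theorem eventually_not_noCrit_of_tendstoUniformlyOn (hh : ∀ x, AnalyticAt ℝ h x) {l : ℕ} {c : ℝ}
    (hc1 : iteratedDeriv (l + 1) h c = 0) (hc0 : iteratedDeriv l h c ≠ 0)
    (hbad : ¬ iteratedDeriv l h c * iteratedDeriv (l + 2) h c < 0)
    (hfin : analyticOrderAt (iteratedDeriv (l + 1) h) c ≠ ⊤)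
    {ι : Type*} {p : Filter ι} (F : ι → ℝ → ℝ) (hF : ∀ k x, AnalyticAt ℝ (F k) x)
    (hconv : ∀ n, TendstoUniformlyOn (fun k => iteratedDeriv n (F k)) (iteratedDeriv n h) p
      (Icc (c - 1) (c + 1))) :
    ∀ᶠ k in p, ¬ HasNoFourierCriticalPoint (F k) := by
  have hA : ∀ n x, AnalyticAt ℝ (iteratedDeriv n h) x := analyticAt_iteratedDeriv hh
  /- the order `m ≥ 1` of `c` as a zero of `h^{(l+1)}` -/
  obtain ⟨m, hm⟩ := ENat.ne_top_iff_exists.mp hfin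
  have hm' : analyticOrderAt (iteratedDeriv (l + 1) h) c = m := hm.symm
  have hder := (analyticOrderAt_eq_nat_iff_iteratedDeriv_eq_zero (hA (l + 1) c)).mp hm'
  have htop : iteratedDeriv (l + 1 + m) h c ≠ 0 := by
    have := hder.2; rwa [iteratedDeriv_iteratedDeriv] at this
  have hDne : ∀ n ≤ l + 1 + m, iteratedDeriv n h ≠ 0 := by
    intro n hn h0
    apply htop
    obtain ⟨j, hj⟩ := Nat.exists_eq_add_of_le hn
    rw [hj, ← iteratedDeriv_iteratedDeriv, h0]
    simp
  /- Step 1: the window `[c - ε, c + ε]`. -/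
  have Ez : ∀ n, ∀ x₀, iteratedDeriv n h x₀ ≠ 0 →
      ∀ᶠ ε in 𝓝[>] (0:ℝ), ∀ x, |x - x₀| ≤ ε → iteratedDeriv n h x ≠ 0 := by
    intro n x₀ hx₀
    have hev : ∀ᶠ x in 𝓝 x₀, iteratedDeriv n h x ≠ 0 := (hA n x₀).continuousAt.eventually_ne hx₀
    rw [Metric.eventually_nhds_iff] at hev
    obtain ⟨δ, hδ, hev⟩ := hev
    filter_upwards [Ioo_mem_nhdsGT hδ] with ε hε x hx
    exact hev (by rw [Real.dist_eq]; exact hx.trans_lt hε.2)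
  have E1 := Ez l c hc0
  have E2 := Ez (l + 1 + m) c htop
  have E3 : ∀ᶠ ε in 𝓝[>] (0:ℝ), ∀ i ∈ Finset.range (m + 2), ∀ t, |t - c| ≤ ε → t ≠ c →
      iteratedDeriv (l + i) h t ≠ 0 := by
    rw [Finset.eventually_all]
    intro i hi
    exact eventually_nhdsGT_no_zero_near (hA (l + i)) (hDne (l + i) (by
      have := Finset.mem_range.mp hi; omega)) c
  have E4 : ∀ᶠ ε in 𝓝[>] (0:ℝ), ε ≤ 1 := by
    filter_upwards [Ioc_mem_nhdsGT (zero_lt_one' ℝ)] with ε hε using hε.2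
  obtain ⟨ε, ⟨hE1, hE2, hE3, hE4⟩, hε⟩ := ((E1.and (E2.and (E3.and E4))).and self_mem_nhdsWithin).exists
  change 0 < ε at hε
  set a := c - ε with ha
  set b := c + ε with hb
  have hab : a < b := by rw [ha, hb]; linarith
  have hcI : c ∈ Ioo a b := ⟨by rw [ha]; linarith, by rw [hb]; linarith⟩
  have hsub : Icc a b ⊆ Icc (c - 1) (c + 1) := Icc_subset_Icc (by rw [ha]; linarith) (by rw [hb]; linarith)
  have haI : a ∈ Icc (c - 1) (c + 1) := hsub ⟨le_rfl, hab.le⟩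
  have hbI : b ∈ Icc (c - 1) (c + 1) := hsub ⟨hab.le, le_rfl⟩
  -- endpoint non-vanishing for the levels `l + i`, `i ≤ m + 1`
  have nza : ∀ i ≤ m + 1, iteratedDeriv (l + i) h a ≠ 0 := fun i hi =>
    hE3 i (Finset.mem_range.mpr (by omega)) a (by rw [ha]; simp [abs_of_pos hε]) (by rw [ha]; linarith)
  have nzb : ∀ i ≤ m + 1, iteratedDeriv (l + i) h b ≠ 0 := fun i hi =>
    hE3 i (Finset.mem_range.mpr (by omega)) b (by rw [hb]; simp [abs_of_pos hε]) (by rw [hb]; linarith)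
  -- zero-freeness of the extreme levels on `[a, b]`
  have zl : ∀ x ∈ Icc a b, iteratedDeriv l h x ≠ 0 := fun x hx =>
    hE1 x (abs_sub_le_iff.mpr ⟨by rw [hb] at hx; linarith [hx.2], by rw [ha] at hx; linarith [hx.1]⟩)
  have zt : ∀ x ∈ Icc a b, iteratedDeriv (l + 1 + m) h x ≠ 0 := fun x hx =>
    hE2 x (abs_sub_le_iff.mpr ⟨by rw [hb] at hx; linarith [hx.2], by rw [ha] at hx; linarith [hx.1]⟩)
  /- Step 2: the level sum for `h` is positive. -/
  have Sh := sum_fourK_iteratedDeriv h a b l (m + 1)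
  rw [zeroCount_eq_zero_of_ne_zero zl, show l + (m + 1) = l + 1 + m by ring,
    zeroCount_eq_zero_of_ne_zero zt] at Sh
  simp only [Nat.cast_zero, mul_zero, sub_self, zero_sub] at Sh
  have Ph : ∀ i ∈ Finset.range (m + 1), 0 ≤ fourK (iteratedDeriv (l + i) h) a b := by
    intro i hi
    have hi' := Finset.mem_range.mp hi
    exact (fourK_iteratedDeriv_nonneg_dvd_iff hh (l + i) (hDne _ (by omega)) hab (nza i (by omega))
      (nza (i + 1) (by omega)) (nzb i (by omega)) (nzb (i + 1) (by omega))).1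
  have Kh : fourK (iteratedDeriv l h) a b ≠ 0 := by
    intro h0
    have := (fourK_iteratedDeriv_nonneg_dvd_iff hh l (hDne _ (by omega)) hab (by simpa using nza 0 (by omega))
      (nza 1 (by omega)) (by simpa using nzb 0 (by omega)) (nzb 1 (by omega))).2.2.mp h0 c hcI hc1 hc0
    exact hbad this
  have hpos : 0 < ∑ i ∈ Finset.range (m + 1), fourK (iteratedDeriv (l + i) h) a b := by
    have h1 : fourK (iteratedDeriv (l + 0) h) a b ≤ ∑ i ∈ Finset.range (m + 1), fourK (iteratedDeriv (l + i) h) a b :=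
      Finset.single_le_sum Ph (Finset.mem_range.mpr (by omega))
    have h2 : 0 < fourK (iteratedDeriv (l + 0) h) a b :=
      lt_of_le_of_ne (by simpa using Ph 0 (Finset.mem_range.mpr (by omega))) (by simpa using Kh.symm)
    exact h2.trans_le h1
  set T := ∑ i ∈ Finset.range (m + 1), (sFF (iteratedDeriv (l + i) h) a - sFF (iteratedDeriv (l + i) h) b)
    with hT
  have hTneg : T < 0 := by rw [Sh] at hpos; linarith
  /- Step 3: what holds eventually along the filter. -/
  obtain ⟨δl, hδl, hδl'⟩ := exists_pos_forall_le_abs hab.le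
    (fun x _ => (hA l x).continuousAt.continuousWithinAt) zl
  obtain ⟨δt, hδt, hδt'⟩ := exists_pos_forall_le_abs hab.le
    (fun x _ => (hA (l + 1 + m) x).continuousAt.continuousWithinAt) zt
  have G1 : ∀ᶠ k in p, ∀ x ∈ Icc a b, iteratedDeriv l (F k) x ≠ 0 := by
    filter_upwards [Metric.tendstoUniformlyOn_iff.mp (hconv l) δl hδl] with k hk x hx h0
    have := hk x (hsub hx)
    rw [h0, Real.dist_eq, sub_zero] at this
    linarith [hδl' x hx]
  have G2 : ∀ᶠ k in p, ∀ x ∈ Icc a b, iteratedDeriv (l + 1 + m) (F k) x ≠ 0 := by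
    filter_upwards [Metric.tendstoUniformlyOn_iff.mp (hconv (l + 1 + m)) δt hδt] with k hk x hx h0
    have := hk x (hsub hx)
    rw [h0, Real.dist_eq, sub_zero] at this
    linarith [hδt' x hx]
  have G3 : ∀ᶠ k in p, ∀ i ∈ Finset.range (m + 2),
      SignType.sign (iteratedDeriv (l + i) (F k) a) = SignType.sign (iteratedDeriv (l + i) h a) ∧
      SignType.sign (iteratedDeriv (l + i) (F k) b) = SignType.sign (iteratedDeriv (l + i) h b) := by
    rw [Finset.eventually_all]
    intro i hi
    have hi' := Finset.mem_range.mp hi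
    have hpa : 0 < |iteratedDeriv (l + i) h a| := abs_pos.mpr (nza i (by omega))
    have hpb : 0 < |iteratedDeriv (l + i) h b| := abs_pos.mpr (nzb i (by omega))
    filter_upwards [Metric.tendstoUniformlyOn_iff.mp (hconv (l + i)) _ hpa,
      Metric.tendstoUniformlyOn_iff.mp (hconv (l + i)) _ hpb] with k hka hkb
    refine ⟨sign_eq_of_abs_sub_lt ?_, sign_eq_of_abs_sub_lt ?_⟩
    · have := hka a haI; rwa [Real.dist_eq, abs_sub_comm] at this
    · have := hkb b hbI; rwa [Real.dist_eq, abs_sub_comm] at this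
  /- Step 4: conclusion. -/
  filter_upwards [G1, G2, G3] with k hk1 hk2 hk3 hN
  -- no derivative of `F k` vanishes identically
  have hFne : F k ≠ 0 := by
    intro h0
    apply hk1 a ⟨le_rfl, hab.le⟩
    rw [h0]
    simp
  have hFD := iteratedDeriv_ne_zero_of_noCrit hN hFne
  -- endpoint facts for `F k`
  have nzFa : ∀ i ≤ m + 1, iteratedDeriv (l + i) (F k) a ≠ 0 := fun i hi =>
    sign_ne_zero.mp (by rw [(hk3 i (Finset.mem_range.mpr (by omega))).1]; exact sign_ne_zero.mpr (nza i hi))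
  have nzFb : ∀ i ≤ m + 1, iteratedDeriv (l + i) (F k) b ≠ 0 := fun i hi =>
    sign_ne_zero.mp (by rw [(hk3 i (Finset.mem_range.mpr (by omega))).2]; exact sign_ne_zero.mpr (nzb i hi))
  -- the level sum for `F k` vanishes by `H` …
  have SF := sum_fourK_iteratedDeriv (F k) a b l (m + 1)
  rw [zeroCount_eq_zero_of_ne_zero hk1, show l + (m + 1) = l + 1 + m by ring,
    zeroCount_eq_zero_of_ne_zero hk2] at SF
  simp only [Nat.cast_zero, mul_zero, sub_self, zero_sub] at SF
  have ZF : ∑ i ∈ Finset.range (m + 1), fourK (iteratedDeriv (l + i) (F k)) a b = 0 := by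
    refine Finset.sum_eq_zero fun i hi => ?_
    have hi' := Finset.mem_range.mp hi
    refine (fourK_iteratedDeriv_nonneg_dvd_iff (hF k) (l + i) (hFD _) hab (nzFa i (by omega))
      (nzFa (i + 1) (by omega)) (nzFb i (by omega)) (nzFb (i + 1) (by omega))).2.2.mpr ?_
    intro x _ hx1 hx0
    exact hN (l + i) x hx1 hx0
  -- … while its sign data equal those of `h`
  have TF : ∑ i ∈ Finset.range (m + 1),
      (sFF (iteratedDeriv (l + i) (F k)) a - sFF (iteratedDeriv (l + i) (F k)) b) = T := by
    rw [hT]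
    refine Finset.sum_congr rfl fun i hi => ?_
    have hi' := Finset.mem_range.mp hi
    unfold sFF
    rw [deriv_iteratedDeriv, deriv_iteratedDeriv, sign_mul, sign_mul, sign_mul, sign_mul,
      show l + i + 1 = l + (i + 1) by ring,
      (hk3 i (Finset.mem_range.mpr (by omega))).1, (hk3 i (Finset.mem_range.mpr (by omega))).2,
      (hk3 (i + 1) (Finset.mem_range.mpr (by omega))).1, (hk3 (i + 1) (Finset.mem_range.mpr (by omega))).2]
  rw [ZF, TF] at SF
  linarith

end semicontinuity

section polynomialLike

/-! ## Functions with a constant derivative of some order (real polynomials) -/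

/-- If `f' ≥ m > 0` eventually at `+∞`, then `f → +∞`. [folklore] -/
theorem tendsto_atTop_of_deriv_ge {f : ℝ → ℝ} (hf : Differentiable ℝ f) {m : ℝ} (hm : 0 < m)
    (h : ∀ᶠ x in atTop, m ≤ deriv f x) : Tendsto f atTop atTop := by
  obtain ⟨T, hT⟩ := eventually_atTop.mp h
  have key : ∀ x, T ≤ x → f T + m * (x - T) ≤ f x := by
    intro x hx
    have := (convex_Ici T).mul_sub_le_image_sub_of_le_deriv hf.continuous.continuousOn
      (hf.differentiableOn) (fun y hy => hT y (by rw [interior_Ici] at hy; exact hy.le)) T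
      (mem_Ici.mpr le_rfl) x (mem_Ici.mpr hx) hx
    linarith
  refine tendsto_atTop_mono' atTop (eventually_atTop.mpr ⟨T, key⟩) ?_
  have h1 : Tendsto (fun x => m * (x - T)) atTop atTop :=
    Tendsto.const_mul_atTop hm (tendsto_atTop_add_const_right _ _ tendsto_id)
  exact tendsto_atTop_add_const_left _ _ h1

/-- **A `C^∞` function whose `k`-th derivative (`k ≥ 1`) is a positive constant tends to `+∞` at
`+∞`, and `(-1)^k f(-x) → +∞`** (the leading term dominates). [folklore] -/
theorem tendsto_atTop_of_iteratedDeriv_eq_const :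
    ∀ (k : ℕ) {f : ℝ → ℝ}, ContDiff ℝ ⊤ f → ∀ {K : ℝ}, 0 < K →
      iteratedDeriv (k + 1) f = (fun _ => K) →
      Tendsto f atTop atTop ∧ Tendsto (fun x => (-1) ^ (k + 1) * f (-x)) atTop atTop := by
  intro k
  induction k with
  | zero =>
    intro f hf K hK h
    rw [zero_add, iteratedDeriv_one] at h
    have hd : Differentiable ℝ f := hf.differentiable (by simp)
    refine ⟨tendsto_atTop_of_deriv_ge hd hK (Eventually.of_forall fun x => by rw [h]), ?_⟩
    have hd' : Differentiable ℝ (fun x => (-1) ^ (0 + 1) * f (-x)) := by fun_prop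
    refine tendsto_atTop_of_deriv_ge hd' hK (Eventually.of_forall fun x => ?_)
    have : deriv (fun x => (-1 : ℝ) ^ (0 + 1) * f (-x)) x = K := by
      rw [deriv_const_mul (d := fun x => f (-x)) _ (by fun_prop), deriv_comp_neg, h]
      simp
    rw [this]
  | succ k ih =>
    intro f hf K hK h
    have hd : Differentiable ℝ f := hf.differentiable (by simp)
    have h' : iteratedDeriv (k + 1) (deriv f) = fun _ => K := by
      rw [← iteratedDeriv_succ', h]
    obtain ⟨ih1, ih2⟩ := ih (hf.deriv') hK h'
    constructor
    · exact tendsto_atTop_of_deriv_ge hd one_pos (ih1.eventually_ge_atTop 1)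
    · have hd' : Differentiable ℝ (fun x => (-1 : ℝ) ^ (k + 1 + 1) * f (-x)) := by fun_prop
      refine tendsto_atTop_of_deriv_ge hd' one_pos ?_
      have hder : ∀ x, deriv (fun x => (-1 : ℝ) ^ (k + 1 + 1) * f (-x)) x =
          (-1) ^ (k + 1) * deriv f (-x) := by
        intro x
        rw [deriv_const_mul (d := fun x => f (-x)) _ (by fun_prop), deriv_comp_neg]
        simp [pow_succ]
      simp only [hder]
      exact ih2.eventually_ge_atTop 1

variable {h : ℝ → ℝ}

/-- A real-analytic function with a constant non-zero derivative of order `d + 1` is unbounded.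
[folklore] -/
theorem not_bounded_of_iteratedDeriv_eq_const (hh : ContDiff ℝ ⊤ h) {d : ℕ} {K : ℝ} (hK : K ≠ 0)
    (hd : iteratedDeriv (d + 1) h = fun _ => K) : ¬ ∃ M, ∀ x, |h x| ≤ M := by
  rintro ⟨M, hM⟩
  -- normalise the sign of `K`
  obtain ⟨g, hg, hgK, hgb⟩ : ∃ g : ℝ → ℝ, ContDiff ℝ ⊤ g ∧
      (iteratedDeriv (d + 1) g = fun _ => |K|) ∧ ∀ x, |g x| ≤ M := by
    rcases lt_or_gt_of_ne hK with hK' | hK'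
    · refine ⟨fun x => -h x, hh.neg, ?_, fun x => by rw [abs_neg]; exact hM x⟩
      funext x
      rw [iteratedDeriv_fun_neg, hd, abs_of_neg hK']
    · exact ⟨h, hh, by rw [hd, abs_of_pos hK'], hM⟩
  have ht := (tendsto_atTop_of_iteratedDeriv_eq_const d hg (abs_pos.mpr hK) hgK).1
  obtain ⟨x, hx⟩ := (ht.eventually_gt_atTop M).exists
  linarith [hgb x, le_abs_self (g x)]

/-- A real-analytic function with a constant non-zero derivative of EVEN order `d + 1` (an odd
degree polynomial) has a real zero. [folklore] -/
theorem exists_zero_of_iteratedDeriv_eq_const_of_even (hh : ContDiff ℝ ⊤ h) {d : ℕ} (hdo : Even d)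
    {K : ℝ} (hK : K ≠ 0) (hd : iteratedDeriv (d + 1) h = fun _ => K) : ∃ x, h x = 0 := by
  -- normalise the sign of `K`
  obtain ⟨g, hg, hgK, hgz⟩ : ∃ g : ℝ → ℝ, ContDiff ℝ ⊤ g ∧
      (iteratedDeriv (d + 1) g = fun _ => |K|) ∧ ∀ x, g x = 0 → h x = 0 := by
    rcases lt_or_gt_of_ne hK with hK' | hK'
    · refine ⟨fun x => -h x, hh.neg, ?_, fun x hx => by simpa using hx⟩
      funext x
      rw [iteratedDeriv_fun_neg, hd, abs_of_neg hK']
    · exact ⟨h, hh, by rw [hd, abs_of_pos hK'], fun x hx => hx⟩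
  obtain ⟨h1, h2⟩ := tendsto_atTop_of_iteratedDeriv_eq_const d hg (abs_pos.mpr hK) hgK
  obtain ⟨x₁, hx₁⟩ := (h1.eventually_gt_atTop 0).exists
  obtain ⟨x₂, hx₂⟩ := (h2.eventually_gt_atTop 0).exists
  have hodd : (-1 : ℝ) ^ (d + 1) = -1 := (Even.add_one hdo).neg_one_pow
  rw [hodd] at hx₂
  have hneg : g (-x₂) < 0 := by linarith
  -- intermediate value theorem between `-x₂` and `x₁`
  have hcont : Continuous g := hg.continuous
  rcases le_or_gt (-x₂) x₁ with hle | hle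
  · obtain ⟨z, _, hz⟩ := intermediate_value_Icc hle hcont.continuousOn ⟨hneg.le, hx₁.le⟩
    exact ⟨z, hgz z hz⟩
  · obtain ⟨z, _, hz⟩ := intermediate_value_Icc' hle.le hcont.continuousOn ⟨hneg.le, hx₁.le⟩
    exact ⟨z, hgz z hz⟩

end polynomialLike

section levelZero

variable {F : ℝ → ℝ}

/-- **A strict local maximum from the second derivative** (via the one-sided signs of `F'`):
if `F'(ξ) = 0` and `F''(ξ) < 0` (`F` real-analytic), then `F x < F ξ` for `x ≠ ξ` near `ξ`. [folklore] -/
theorem eventually_lt_of_deriv_eq_zero_of_deriv_deriv_neg (hF : ∀ x, AnalyticAt ℝ F x) {ξ : ℝ}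
    (h1 : deriv F ξ = 0) (h2 : deriv (deriv F) ξ < 0) : ∀ᶠ x in 𝓝[≠] ξ, F x < F ξ := by
  have hdF : ∀ x, AnalyticAt ℝ (deriv F) x := fun x => (hF x).deriv
  have hcont : Continuous F := continuous_iff_continuousAt.mpr fun x => (hF x).continuousAt
  have hord : analyticOrderAt (deriv F) ξ = (1 : ℕ) := by
    rw [Nat.cast_one]; exact (hdF ξ).analyticOrderAt_eq_one_of_zero_deriv_ne_zero h1 h2.ne
  have hR := eventually_nhdsGT_sign_eq (hdF ξ) hord
  have hL := eventually_nhdsLT_sign_eq (hdF ξ) hord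
  rw [iteratedDeriv_one, sign_neg h2] at hR hL
  obtain ⟨u, hu, hRu⟩ := mem_nhdsGT_iff_exists_Ioo_subset.mp hR
  obtain ⟨v, hv, hLv⟩ := mem_nhdsLT_iff_exists_Ioo_subset.mp hL
  have hanti : StrictAntiOn F (Icc ξ u) :=
    strictAntiOn_of_deriv_neg (convex_Icc ξ u) hcont.continuousOn fun x hx => by
      rw [interior_Icc] at hx
      exact sign_eq_neg_one_iff.mp (hRu hx)
  have hmono : StrictMonoOn F (Icc v ξ) :=
    strictMonoOn_of_deriv_pos (convex_Icc v ξ) hcont.continuousOn fun x hx => by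
      rw [interior_Icc] at hx
      have h' : SignType.sign (deriv F x) = (-1) ^ 1 * -1 := hLv hx
      have h'' : SignType.sign (deriv F x) = 1 := by rw [h']; decide
      exact sign_eq_one_iff.mp h''
  have hmem : Ioo v u \ {ξ} ∈ 𝓝[≠] ξ := sdiff_mem_nhdsWithin_compl (Ioo_mem_nhds hv hu) {ξ}
  filter_upwards [hmem] with x hx
  have hxI : x ∈ Ioo v u := hx.1
  have hxne : x ≠ ξ := hx.2
  rcases lt_or_gt_of_ne hxne with hlt | hgt
  · exact hmono ⟨hxI.1.le, hlt.le⟩ ⟨hv.le, le_rfl⟩ hlt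
  · exact hanti ⟨le_rfl, hu.le⟩ ⟨hgt.le, hxI.2.le⟩ hgt

/-- A zero-free continuous function on `ℝ` has constant sign. [folklore] -/
theorem sign_eq_sign_of_forall_ne_zero (hc : Continuous F) (h0 : ∀ x, F x ≠ 0) (x y : ℝ) :
    SignType.sign (F x) = SignType.sign (F y) := by
  set R := max |x| |y| + 1 with hR
  have hx : x ∈ Ioo (-R) R := by
    constructor <;> [have := neg_abs_le x; have := le_abs_self x] <;>
      [linarith [le_max_left |x| |y|]; linarith [le_max_left |x| |y|]]
  have hy : y ∈ Ioo (-R) R := by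
    constructor <;> [have := neg_abs_le y; have := le_abs_self y] <;>
      [linarith [le_max_right |x| |y|]; linarith [le_max_right |x| |y|]]
  exact sign_eq_sign_of_ne_zero hc.continuousOn (fun z _ => h0 z) hx hy

/-- **The level-`0` mechanism of Ki–Kim's Lemma 4.3** ("`x = a` is the only real zero of `f'` and
`sg f f' = 1` for `x < a`, `-1` for `x > a`; this implies that `f` is bounded"): if `F > 0` is
real-analytic, every zero `a` of `F'` has `F''(a) < 0`, and `F'` has a zero `a₀`, then `a₀` is the
only zero of `F'` and `F ≤ F(a₀)` everywhere. [cite: KiKim2000, Lemma 4.3 (proof)] -/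
theorem bounded_of_forall_deriv_zero_lt (hF : ∀ x, AnalyticAt ℝ F x)
    (hall : ∀ a, deriv F a = 0 → deriv (deriv F) a < 0) {a₀ : ℝ} (ha₀ : deriv F a₀ = 0) :
    ∀ x, F x ≤ F a₀ := by
  have hdF : ∀ x, AnalyticAt ℝ (deriv F) x := fun x => (hF x).deriv
  have hcont : Continuous F := continuous_iff_continuousAt.mpr fun x => (hF x).continuousAt
  have hcont' : Continuous (deriv F) := continuous_iff_continuousAt.mpr fun x => (hdF x).continuousAt
  have hdiff : Differentiable ℝ F := fun x => (hF x).differentiableAt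
  have smax : ∀ a, deriv F a = 0 → ∀ᶠ x in 𝓝[≠] a, F x < F a := fun a ha =>
    eventually_lt_of_deriv_eq_zero_of_deriv_deriv_neg hF ha (hall a ha)
  -- at most one zero of `F'`
  have uniq : ∀ a b, deriv F a = 0 → deriv F b = 0 → a < b → False := by
    intro a b ha hb hab
    obtain ⟨ξ, hξ, hmin⟩ := isCompact_Icc.exists_isMinOn (nonempty_Icc.mpr hab.le) hcont.continuousOn
    rcases eq_or_lt_of_le hξ.1 with hξa | hξa
    · -- minimum at the left end, which is a strict local maximum
      have h1 : ∀ᶠ x in 𝓝[>] a, F x < F a :=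
        (smax a ha).filter_mono (nhdsWithin_mono _ fun _ h => h.ne')
      obtain ⟨x, hx1, hx2⟩ := (h1.and (Ioo_mem_nhdsGT hab)).exists
      have h2 := hmin (Ioo_subset_Icc_self hx2)
      rw [← hξa] at h2
      exact absurd h2 (not_le.mpr hx1)
    rcases eq_or_lt_of_le hξ.2 with hξb | hξb
    · have h1 : ∀ᶠ x in 𝓝[<] b, F x < F b := (smax b hb).filter_mono (nhdsLT_le_nhdsNE b)
      obtain ⟨x, hx1, hx2⟩ := (h1.and (Ioo_mem_nhdsLT hab)).exists
      have h2 := hmin (Ioo_subset_Icc_self hx2)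
      rw [hξb] at h2
      exact absurd h2 (not_le.mpr hx1)
    · -- interior minimum: a critical point, hence a strict local maximum — absurd
      have hloc : IsLocalMin F ξ := by
        show ∀ᶠ x in 𝓝 ξ, F ξ ≤ F x
        filter_upwards [Icc_mem_nhds hξa hξb] with x hx using hmin hx
      have hξ' : deriv F ξ = 0 := hloc.deriv_eq_zero
      have h1 := smax ξ hξ'
      have h2 : ∀ᶠ x in 𝓝[≠] ξ, F ξ ≤ F x := by
        have : Icc a b ∈ 𝓝[≠] ξ := mem_nhdsWithin_of_mem_nhds (Icc_mem_nhds hξa hξb)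
        filter_upwards [this] with x hx using hmin hx
      obtain ⟨x, hx1, hx2⟩ := (h1.and h2).exists
      exact absurd hx2 (not_le.mpr hx1)
  have honly : ∀ a, deriv F a = 0 → a = a₀ := by
    intro a ha
    rcases lt_trichotomy a a₀ with h | h | h
    · exact (uniq a a₀ ha ha₀ h).elim
    · exact h
    · exact (uniq a₀ a ha₀ ha h).elim
  -- the sign of `F'` right and left of `a₀`
  have hord : analyticOrderAt (deriv F) a₀ = (1 : ℕ) := by
    rw [Nat.cast_one]; exact (hdF a₀).analyticOrderAt_eq_one_of_zero_deriv_ne_zero ha₀ (hall a₀ ha₀).ne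
  have hR := eventually_nhdsGT_sign_eq (hdF a₀) hord
  have hL := eventually_nhdsLT_sign_eq (hdF a₀) hord
  rw [iteratedDeriv_one, sign_neg (hall a₀ ha₀)] at hR hL
  have hneg : ∀ x, a₀ < x → deriv F x < 0 := by
    intro x hx
    by_contra hcon
    push Not at hcon
    rcases eq_or_lt_of_le hcon with h0 | hpos'
    · exact absurd (honly x h0.symm) hx.ne'
    · -- `F' < 0` just right of `a₀`, `F' x > 0`: a zero of `F'` in between
      obtain ⟨y, hy1, hy2⟩ := (hR.and (Ioo_mem_nhdsGT hx)).exists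
      have hy1' : deriv F y < 0 := sign_eq_neg_one_iff.mp hy1
      obtain ⟨z, hz, hz0⟩ := intermediate_value_Ioo hy2.2.le hcont'.continuousOn ⟨hy1', hpos'⟩
      have hza := honly z hz0
      rw [hza] at hz
      exact absurd hz.1 (not_lt.mpr hy2.1.le)
  have hposd : ∀ x, x < a₀ → 0 < deriv F x := by
    intro x hx
    by_contra hcon
    push Not at hcon
    rcases eq_or_lt_of_le hcon with h0 | hneg'
    · exact absurd (honly x h0) hx.ne
    · obtain ⟨y, hy1, hy2⟩ := (hL.and (Ioo_mem_nhdsLT hx)).exists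
      have hy1' : 0 < deriv F y := by
        have h' : SignType.sign (deriv F y) = 1 := by rw [hy1]; decide
        exact sign_eq_one_iff.mp h'
      obtain ⟨z, hz, hz0⟩ := intermediate_value_Ioo hy2.1.le hcont'.continuousOn ⟨hneg', hy1'⟩
      have hza := honly z hz0
      rw [hza] at hz
      exact absurd hz.2 (not_lt.mpr hy2.2.le)
  -- monotonicity on both sides
  intro x
  rcases le_or_gt a₀ x with hx | hx
  · have hanti : AntitoneOn F (Ici a₀) := antitoneOn_of_deriv_nonpos (convex_Ici a₀) hcont.continuousOn
      hdiff.differentiableOn fun y hy => (hneg y (by rwa [interior_Ici] at hy)).le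
    exact hanti (mem_Ici.mpr le_rfl) (mem_Ici.mpr hx) hx
  · have hmono : MonotoneOn F (Iic a₀) := monotoneOn_of_deriv_nonneg (convex_Iic a₀) hcont.continuousOn
      hdiff.differentiableOn fun y hy => (hposd y (by rwa [interior_Iic] at hy)).le
    exact hmono (mem_Iic.mpr hx.le) (mem_Iic.mpr le_rfl) hx.le

/-- The level-`0` mechanism for a zero-free real-analytic `F` (either sign): if every zero `a` of
`F'` has `F(a) F''(a) < 0` and `F'` has a zero, then `F` is bounded. [cite: KiKim2000, Lemma 4.3 (proof)] -/
theorem bounded_of_forall_deriv_zero_mul_lt (hF : ∀ x, AnalyticAt ℝ F x) (h0 : ∀ x, F x ≠ 0)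
    (hall : ∀ a, deriv F a = 0 → F a * deriv (deriv F) a < 0) {a₀ : ℝ} (ha₀ : deriv F a₀ = 0) :
    ∀ x, |F x| ≤ |F a₀| := by
  have hcont : Continuous F := continuous_iff_continuousAt.mpr fun x => (hF x).continuousAt
  set s : ℝ := F a₀ with hs
  set G : ℝ → ℝ := fun x => s * F x with hG
  have hGa : ∀ x, AnalyticAt ℝ G x := fun x => analyticAt_const.mul (hF x)
  have hsame : ∀ x, 0 < G x := by
    intro x
    have h1 := sign_eq_sign_of_forall_ne_zero hcont h0 x a₀
    simp only [hG, hs]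
    rcases lt_or_gt_of_ne (h0 a₀) with h | h
    · rw [sign_neg h, sign_eq_neg_one_iff] at h1; nlinarith
    · rw [sign_pos h, sign_eq_one_iff] at h1; nlinarith
  have hdG : ∀ x, deriv G x = s * deriv F x := fun x => by
    simp only [hG]; exact deriv_const_mul s (hF x).differentiableAt
  have hddG : ∀ x, deriv (deriv G) x = s * deriv (deriv F) x := fun x => by
    rw [show deriv G = fun x => s * deriv F x from funext hdG]
    exact deriv_const_mul s (hF x).deriv.differentiableAt
  have hs0 : s ≠ 0 := h0 a₀
  have hallG : ∀ a, deriv G a = 0 → deriv (deriv G) a < 0 := by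
    intro a ha
    rw [hdG] at ha
    have ha' : deriv F a = 0 := (mul_eq_zero.mp ha).resolve_left hs0
    have := hall a ha'
    have hG0 : 0 < G a := hsame a
    simp only [hG] at hG0
    rw [hddG]
    -- `s F(a) > 0` and `F(a) F''(a) < 0` give `s F''(a) < 0`
    have hFa : F a ≠ 0 := h0 a
    have : s * deriv (deriv F) a * (F a * F a) = (s * F a) * (F a * deriv (deriv F) a) := by ring
    have hsq : 0 < F a * F a := mul_self_pos.mpr hFa
    nlinarith
  have key := bounded_of_forall_deriv_zero_lt hGa hallG (a₀ := a₀) (by rw [hdG, ha₀, mul_zero])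
  intro x
  have h1 := key x
  simp only [hG] at h1
  have h2 : 0 < s * F x := hsame x
  have h3 : |s| * |F x| ≤ |s| * |F a₀| := by
    rw [← abs_mul, ← abs_mul, abs_of_pos h2, abs_of_pos (hsame a₀)]
    exact h1
  exact le_of_mul_le_mul_left h3 (abs_pos.mpr hs0)

/-- **A zero-free real polynomial of positive degree has a genuine Fourier critical point**
(de Gua; Ki–Kim 2000 §1: "a real polynomial has just as many critical points as couples of
nonreal zeros" — here only: at least one). Hypotheses: `h` real-analytic with `h^{(d+1)} ≡ K ≠ 0`
and `h ≠ 0` on `ℝ`; conclusion: a zero `a` of `h'` (necessarily of finite order) at which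
`h(a) h''(a) < 0` fails. [cite: KiKim2000, §1 (de Gua's rule)] -/
theorem exists_genuine_crit_of_iteratedDeriv_eq_const {h : ℝ → ℝ} (hh : ∀ x, AnalyticAt ℝ h x) {d : ℕ} {K : ℝ}
    (hK : K ≠ 0) (hd : iteratedDeriv (d + 1) h = fun _ => K) (h0 : ∀ x, h x ≠ 0) :
    ∃ a, deriv h a = 0 ∧ ¬ (h a * deriv (deriv h) a < 0) ∧ analyticOrderAt (deriv h) a ≠ ⊤ := by
  have hcd : ContDiff ℝ ⊤ h := by
    rw [contDiff_iff_contDiffAt]; exact fun x => (hh x).contDiffAt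
  -- `d` is odd: otherwise `h` itself has a zero
  have hdo : ¬ Even d := fun he =>
    (exists_zero_of_iteratedDeriv_eq_const_of_even hcd he hK hd).elim fun x hx => h0 x hx
  obtain ⟨d', rfl⟩ : ∃ d', d = d' + 1 := ⟨d - 1, by
    rcases d with _ | d
    · exact absurd Even.zero hdo
    · omega⟩
  have hd'e : Even d' := by
    rcases Nat.even_or_odd d' with he | ho
    · exact he
    · exact absurd ho.add_one hdo
  -- `h'` has a zero
  have hd1 : iteratedDeriv (d' + 1) (deriv h) = fun _ => K := by
    rw [← iteratedDeriv_succ', hd]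
  obtain ⟨a₁, ha₁⟩ := exists_zero_of_iteratedDeriv_eq_const_of_even hcd.deriv' hd'e hK hd1
  -- `h'` is not identically zero
  have hdne : deriv h ≠ 0 := by
    intro h0'
    have := congr_fun hd1 0
    rw [h0'] at this
    simp at this
    exact hK (by linarith)
  -- if every zero of `h'` were good, `h` would be bounded
  by_contra hcon
  push Not at hcon
  have hall : ∀ a, deriv h a = 0 → h a * deriv (deriv h) a < 0 := by
    intro a ha
    by_contra hbad
    exact analyticOrderAt_ne_top_of_ne_zero (fun x => (hh x).deriv) hdne a (hcon a ha (not_lt.mp hbad))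
  have hb := bounded_of_forall_deriv_zero_mul_lt hh h0 hall ha₁
  exact not_bounded_of_iteratedDeriv_eq_const hcd hK hd ⟨_, hb⟩

end levelZero

end KiKim
end Literature.Analysis.Complex
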